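import Summits.AtomisticToContinuum.Crystallization.Theorems.ReggeStarCoercivityDefectFreeCrystallizesExactSelectionLaw
import Summits.AtomisticToContinuum.Crystallization.Theorems.SquareWellLayerCakeStackingFaultSparsityOfLaminarBarlowWindows
import Summits.AtomisticToContinuum.Crystallization.Theorems.PricedLinkCensusStackingHingeDilationPinningScales
import Summits.AtomisticToContinuum.Crystallization.Theorems.PricedLinkCensusStackingHingeOfSupportCore
import Summits.AtomisticToContinuum.Crystallization.Theorems.FreeSplittingCertificatesExactHcpShellsRigidity
import Literature.Probability.Process.PointStationaryLaw

/-!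
# `StackingHinge` (stmt-AtomisticToContinuum-14993), line `Sketch` (skeleton v37): stub `stub_dilationPinning` (V6)

DILATION PINNING.  For the relaxed hcp reference `(a₀, h₀)` (the box `[0.945, 0.995] × [0.77, 0.815]`
and global minimality of `hcpE`), a probability law on counting measures of `ℝ³` which is a.s. the
counting measure of a DILATED rotated exact stacking `t • A(barlowStacking a₀ h s)` (`t > 0`,
`h ∈ {h₀, a₀ √(2/3)}`, `s` a Hägg word, all sample-dependent) and whose mean root energy is
`≤ hcpE a₀ h₀`, is a.s. the counting measure of an UNDILATED one (`t = 1`; the conclusion is verbatim the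
hypothesis of the landed X3 `PalmGoodLaw.ExactSelectionLaw.stub_exactSelectionLaw`).

Proof.  `t • A(barlowStacking a₀ h s) = A(barlowStacking (t a₀) (t h) s)` (`smul_image_image_barlowStacking`,
over the landed `ExactHcpShells.smul_image_barlowStacking`),
so the root energy of a sample is the site energy `barlowSiteEnergy lennardJones b h' s 0` at in-layer
spacing `b = t a₀` and layer spacing `h' = t h`, ratio `h'/b = h/a₀ ∈ [0.8161, 0.85]` (minimiser
enclosure `tube_minimiserEnclosure`, resp. `√(2/3)`).  The deterministic core
`siteEnergy_floor_and_pin` compares it with the level `hcpE a₀ h₀ ≤ −0.7175` at EVERY scale `b > 0`,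
uniformly in the word:

* `b ∈ [0.94, 1]` (item 3063's box): the landed column `SiteColumnLJ.stub_siteColumnLJ` gives
  `≥ hcpE b h' ≥ hcpE a₀ h₀`, and equality forces `(b, h') = (a₀, h₀)` (`tube_hcpE_unique_minimiser`),
  i.e. `t = 1`;
* `(b, h') ∈ (1/2, 2)²` off the box: the landed certified OFF-BOX SCALE GAP of crux 14296
  (`OfLaminarBarlowWindows.stub_offBoxScaleGap`: `e(hcp a₁ h₁) + γ ≤ e₀(b,h') − ∑_{k ≥ 2} |J_k(b,h')|`,
  `γ > 0`) and the word-free minorant `e₀ − ∑|J_k| ≤ barlowSiteEnergy` (`latticeSiteSum_ge`) give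
  `> hcpE a₀ h₀` strictly (`hcpE a₀ h₀ ≤ hcpE a₁ h₁` by global minimality);
* `h' ≤ 1/2` (then `b ≤ 0.6127`): `barlowSiteEnergy ≥ 0` (`siteEnergy_compressed_nonneg`, packing);
* `b ≥ 2`: `barlowSiteEnergy ≥ −7/20` (`siteEnergy_dilute`, shell sum).

So a.s. the root energy is `≥ hcpE a₀ h₀`; the level is negative (`hcpE_neg_of_isMin`), hence not the
junk value of the Bochner integral, and the mean ceiling forces a.s. EQUALITY
(`ae_eq_const_of_integral_le`), which only the box allows, with `t = 1`.  (The hard-core and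
stationarity hypotheses of the registered signature are not needed.)  All `[folklore]`.
-/

noncomputable section

namespace Summit.AtomisticToContinuum.Crystallization.Theorems.PricedHcpWindowsDilationPinning

open MeasureTheory Set
open Literature.MathematicalPhysics.StatisticalMechanics Literature.Probability.Process
open Summit.AtomisticToContinuum.Crystallization.Theorems.PalmUnimodularRigidity.LayeredLawsSelectHcp
  (hcpE hcpQ tube_hcpE_unique_minimiser tube_minimiserEnclosure)
open Summit.AtomisticToContinuum.Crystallization.Theorems.ExcessDecayLiouvilleCoarseGrains
  (hcpEnergySeries_of_eq)
open Summit.AtomisticToContinuum.Crystallization.Theorems.SquareWellLayerCake.StackingFaultSparsity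
  (InBox latticeSiteSum_ge tsum_stacking_eq_tsum_barlowPos
    tsum_barlowPos_eq_two_mul_barlowSiteEnergy_of_word stub_offBoxRef)
open Summit.AtomisticToContinuum.Crystallization.Theorems.SquareWellLayerCake.StackingFaultSparsity.OfLaminarBarlowWindows
  (stub_offBoxScaleGap)
open Summit.AtomisticToContinuum.Crystallization.Theorems.PalmGoodLaw.ExactSelectionLaw
  (rootEnergy_eq_barlowSiteEnergy_zero column_box hcpE_neg_of_isMin ae_eq_const_of_integral_le)

/-! ## Dilating a rotated stacking -/

/-- **Dilating a rotated stacking**: `t • (A '' barlowStacking a h s) = A '' barlowStacking (t a) (t h) s`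
for a linear isometry `A` (the landed `ExactHcpShells.smul_image_barlowStacking` composed with `A`).
[folklore] -/
theorem smul_image_image_barlowStacking (t a h : ℝ) (s : ℤ → ℤ)
    (A : EuclideanSpace ℝ (Fin 3) ≃ₗᵢ[ℝ] EuclideanSpace ℝ (Fin 3)) :
    (fun z : EuclideanSpace ℝ (Fin 3) => t • z) '' (A '' barlowStacking a h s) =
      A '' barlowStacking (t * a) (t * h) s := by
  rw [← ExactHcpShells.smul_image_barlowStacking, Set.image_image, Set.image_image]
  exact Set.image_congr fun z _ => (map_smul A t z).symm

/-! ## The level and the word-free minorant -/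

/-- **The level is at most `−0.7175`**: the global minimum of `hcpE` lies below the certified value
`e(hcp 0.9713 (0.9713 · 0.8164)) ≤ −0.7175` (`stub_offBoxRef`, `hcpEnergySeries_of_eq`). [folklore] -/
theorem hcpE_le_ref {a₀ h₀ : ℝ} (hmin : ∀ a h : ℝ, 0 < a → 0 < h → hcpE a₀ h₀ ≤ hcpE a h) :
    hcpE a₀ h₀ ≤ -(7175 / 10000) := by
  have ha : (9713 / 10000 : ℝ) ≠ 0 := by norm_num
  have hh : (9713 / 10000 * (8164 / 10000) : ℝ) ≠ 0 := by norm_num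
  have h1 := stub_offBoxRef ha hh
  have hE : (hcpPeriodicConfiguration ha hh).energyPerParticle lennardJones =
      hcpE (9713 / 10000) (9713 / 10000 * (8164 / 10000)) :=
    (hcpEnergySeries_of_eq _ _ ha hh hcpQ rfl).2.2
  have h2 := hmin (9713 / 10000) (9713 / 10000 * (8164 / 10000)) (by norm_num) (by norm_num)
  rw [hE] at h1
  linarith

/-- **The word-free minorant**: `e₀(a, h) − ∑_{k ≥ 2} |J_k(a, h)| ≤ barlowSiteEnergy lennardJones a h s 0`
for `a, h > 0` and a Hägg word `s` (`latticeSiteSum_ge` read through the `ℤ³` parametrisation and the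
layer-by-layer regrouping `tsum_barlowPos_eq_two_mul_barlowSiteEnergy_of_word`). [folklore] -/
theorem base_sub_le_siteEnergy {a h : ℝ} (ha : 0 < a) (hh : 0 < h) {s : ℤ → ℤ} (hs : IsHaggSeq s) :
    barlowBaseEnergy lennardJones a h - ∑' n : ℕ, |barlowCoupling lennardJones a h (n + 2)| ≤
      barlowSiteEnergy lennardJones a h s 0 := by
  have h1 := latticeSiteSum_ge ha hh hs 0 0 0
  rw [tsum_stacking_eq_tsum_barlowPos ha hh s 0 0 0,
    tsum_barlowPos_eq_two_mul_barlowSiteEnergy_of_word ha hh s 0] at h1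
  linarith

/-! ## The four regimes of the scale -/

/-- **Off the box inside `(1/2, 2)²`** the site energy of every Hägg word lies STRICTLY above the level:
the certified off-box scale gap of crux 14296 (`stub_offBoxScaleGap`) bounds the word-free minorant
below by `e(hcp a₁ h₁) + γ`, `γ > 0`, and `hcpE a₀ h₀ ≤ hcpE |a₁| |h₁| = e(hcp a₁ h₁)` by global
minimality. [folklore] -/
theorem hcpE_lt_siteEnergy_offbox {a₀ h₀ : ℝ}
    (hmin : ∀ a h : ℝ, 0 < a → 0 < h → hcpE a₀ h₀ ≤ hcpE a h) {b h' : ℝ} (hb1 : 1 / 2 < b)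
    (hb2 : b < 2) (hh1 : 1 / 2 < h') (hh2 : h' < 2) (hbox : ¬ InBox b h') {s : ℤ → ℤ}
    (hs : IsHaggSeq s) : hcpE a₀ h₀ < barlowSiteEnergy lennardJones b h' s 0 := by
  obtain ⟨a₁, h₁, ha₁, hh₁, γ, hγ, hgap⟩ := stub_offBoxScaleGap
  have hE : (hcpPeriodicConfiguration ha₁ hh₁).energyPerParticle lennardJones = hcpE a₁ h₁ :=
    (hcpEnergySeries_of_eq a₁ h₁ ha₁ hh₁ hcpQ rfl).2.2
  have habs : hcpE |a₁| |h₁| = hcpE a₁ h₁ := by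
    simp only [PalmUnimodularRigidity.LayeredLawsSelectHcp.hcpE, sq_abs]
  have h1 : hcpE a₀ h₀ ≤ hcpE a₁ h₁ := by
    have := hmin |a₁| |h₁| (abs_pos.2 ha₁) (abs_pos.2 hh₁)
    rwa [habs] at this
  have h2 := hgap b h' hb1 hb2 hh1 hh2 hbox
  have h3 := base_sub_le_siteEnergy (by linarith) (by linarith) hs (a := b) (h := h')
  rw [hE] at h2
  linarith

/-- **On the box** `47/50 ≤ b ≤ 1`, `39/50 b ≤ h' ≤ 17/20 b` the site energy of every Hägg word is at
least the hcp level `hcpE b h'` at the same parameters (the landed column `SiteColumnLJ.stub_siteColumnLJ`,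
whose cubic-side deficit is non-negative). [folklore] -/
theorem hcpE_le_siteEnergy_box {b h' : ℝ} (hb1 : 47 / 50 ≤ b) (hb2 : b ≤ 1)
    (hlo : 39 / 50 * b ≤ h') (hhi : h' ≤ 17 / 20 * b) {s : ℤ → ℤ} (hs : IsHaggSeq s) :
    hcpE b h' ≤ barlowSiteEnergy lennardJones b h' s 0 := by
  -- adapted from `PalmGoodLaw.ExactSelectionLaw.stub_exactSelectionLaw` (step `hge`)
  obtain ⟨hJ, hcolumn⟩ := PalmGoodLaw.SiteColumnLJ.stub_siteColumnLJ b h' hb1 hb2 hlo hhi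
  have h1 := hcolumn s hs 0
  have hI₁ : (0 : ℝ) ≤ (if s (0 + 1) = s 0 then 1 else 0) := by split_ifs <;> norm_num
  have hI₂ : (0 : ℝ) ≤ (if s (0 - 1) = s (0 - 2) then 1 else 0) := by split_ifs <;> norm_num
  have h3 : 0 ≤ 1 / 2 * (barlowCoupling lennardJones b h' 3 - barlowCoupling lennardJones b h' 2) *
      ((if s (0 + 1) = s 0 then 1 else 0) + (if s (0 - 1) = s (0 - 2) then 1 else 0) : ℝ) :=
    mul_nonneg (by linarith) (by linarith)
  linarith

/-- **The deterministic core: floor and pinning at every scale.**  For the relaxed reference `(a₀, h₀)`,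
`h ∈ {h₀, a₀ √(2/3)}`, a Hägg word `s` and a dilation `t > 0`, the site energy of
`barlowStacking (t a₀) (t h) s` is `≥ hcpE a₀ h₀`, with equality only if `t = 1`: the box (column +
uniqueness of the minimiser), the compressed scales `t h ≤ 1/2` (`≥ 0`), the dilute scales `t a₀ ≥ 2`
(`≥ −7/20 > −0.7175 ≥ hcpE a₀ h₀`), and the certified off-box scale gap in between. [folklore] -/
theorem siteEnergy_floor_and_pin {a₀ h₀ : ℝ} (ha₁ : 189 / 200 ≤ a₀) (ha₂ : a₀ ≤ 199 / 200)
    (hh₁ : 77 / 100 ≤ h₀) (hh₂ : h₀ ≤ 163 / 200)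
    (hmin : ∀ a h : ℝ, 0 < a → 0 < h → hcpE a₀ h₀ ≤ hcpE a h)
    {h : ℝ} (hh : h = h₀ ∨ h = a₀ * Real.sqrt (2 / 3)) {s : ℤ → ℤ} (hs : IsHaggSeq s)
    {t : ℝ} (ht : 0 < t) :
    hcpE a₀ h₀ ≤ barlowSiteEnergy lennardJones (t * a₀) (t * h) s 0 ∧
      (barlowSiteEnergy lennardJones (t * a₀) (t * h) s 0 ≤ hcpE a₀ h₀ → t = 1) := by
  have ha0 : 0 < a₀ := by linarith
  have hh0 : 0 < h₀ := by linarith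
  obtain ⟨hpos, hlo, hhi⟩ := column_box ha₁ ha₂ hh₁ hh₂ hmin hh
  -- the sharper lower ratio bound `h ≥ 0.8161 a₀`
  have hlo' : 8161 / 10000 * a₀ ≤ h := by
    rcases hh with rfl | rfl
    · obtain ⟨hA, hH⟩ := tube_minimiserEnclosure a₀ h ha₁ ha₂ hh₁ hh₂ hmin
      rw [abs_le] at hA hH
      linarith [hA.1, hA.2, hH.1, hH.2]
    · have : (8161 / 10000 : ℝ) ≤ Real.sqrt (2 / 3) := Real.le_sqrt_of_sq_le (by norm_num)
      nlinarith
  have hneg : hcpE a₀ h₀ ≤ -(7175 / 10000) := hcpE_le_ref hmin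
  set b := t * a₀ with hb
  set h' := t * h with hh'
  have hb0 : 0 < b := mul_pos ht ha0
  have hh'0 : 0 < h' := mul_pos ht hpos
  have hr1 : 8161 / 10000 * b ≤ h' := by
    have := mul_le_mul_of_nonneg_left hlo' ht.le
    rw [hb, hh']
    linarith
  have hr2 : 39 / 50 * b ≤ h' := by
    have := mul_le_mul_of_nonneg_left hlo ht.le
    rw [hb, hh']
    linarith
  have hr3 : h' ≤ 17 / 20 * b := by
    have := mul_le_mul_of_nonneg_left hhi ht.le
    rw [hb, hh']
    linarith
  by_cases hbox : 47 / 50 ≤ b ∧ b ≤ 1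
  · -- the column and the unique minimiser
    have hcol := hcpE_le_siteEnergy_box hbox.1 hbox.2 hr2 hr3 hs
    have hmin' := hmin b h' hb0 hh'0
    refine ⟨hmin'.trans hcol, fun hle => ?_⟩
    have heq : hcpE b h' = hcpE a₀ h₀ := le_antisymm (hcol.trans hle) hmin'
    have hba := (tube_hcpE_unique_minimiser a₀ h₀ b h' ha0 hh0 hb0 hh'0 hmin heq).1
    have hba' : t * a₀ = 1 * a₀ := by rw [one_mul]; exact hba
    exact mul_right_cancel₀ ha0.ne' hba'
  by_cases hcomp : h' ≤ 1 / 2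
  · -- compressed
    have hb1 : b ≤ 6127 / 10000 := by linarith
    have h0 := siteEnergy_compressed_nonneg hb0 hb1 hr1 hs
    exact ⟨by linarith, fun hle => by exfalso; linarith⟩
  by_cases hdil : 2 ≤ b
  · -- dilute
    have h0 := siteEnergy_dilute hdil hr1 hs
    exact ⟨by linarith, fun hle => by exfalso; linarith⟩
  -- off the box inside `(1/2, 2)²`
  push Not at hcomp hdil
  have hb1 : 1 / 2 < b := by linarith
  have hh2 : h' < 2 := by linarith
  have hnot : ¬ InBox b h' := fun hin => hbox ⟨hin.1, hin.2.1⟩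
  have hlt := hcpE_lt_siteEnergy_offbox hmin hb1 hdil hcomp hh2 hnot hs
  exact ⟨hlt.le, fun hle => absurd hle (not_le.2 hlt)⟩

/-! ## The registered stub -/

/-- **V6 `stub_dilationPinning`: DILATION PINNING.**  For the relaxed reference `(a₀, h₀)` (box + global
`hcpE`-minimality), a probability law on counting measures of `ℝ³` which is a.s. the counting measure of a
dilated rotated exact stacking `t • A(barlowStacking a₀ h s)` (`t > 0`, `h ∈ {h₀, a₀ √(2/3)}`, `s` Hägg)
with mean root energy `≤ hcpE a₀ h₀` is a.s. the counting measure of an undilated one.  Proof: a.s. the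
root energy is the site energy of `barlowStacking (t a₀) (t h) s`, which is `≥ hcpE a₀ h₀` at every
scale (`siteEnergy_floor_and_pin`: column on the box, certified off-box scale gap, packing bounds at the
extreme scales); the level is negative, so the mean ceiling forces a.s. equality, which pins `t = 1`.
(The hard-core and stationarity hypotheses are not used.) [folklore] -/
theorem stub_dilationPinning : ∀ a₀ h₀ : ℝ, 189 / 200 ≤ a₀ → a₀ ≤ 199 / 200 → 77 / 100 ≤ h₀ → h₀ ≤ 163 / 200 → (∀ a h : ℝ, 0 < a → 0 < h → Summit.AtomisticToContinuum.Crystallization.Theorems.PalmUnimodularRigidity.LayeredLawsSelectHcp.hcpE a₀ h₀ ≤ Summit.AtomisticToContinuum.Crystallization.Theorems.PalmUnimodularRigidity.LayeredLawsSelectHcp.hcpE a h) → ∀ δ : ℝ, 0 < δ → ∀ P : MeasureTheory.Measure (MeasureTheory.Measure (EuclideanSpace ℝ (Fin 3))), MeasureTheory.IsProbabilityMeasure P → (∀ᵐ μ ∂P, (∃ S : Set (EuclideanSpace ℝ (Fin 3)), (0 : EuclideanSpace ℝ (Fin 3)) ∈ S ∧ (∀ x ∈ S, ∀ y ∈ S,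 x ≠ y → δ ≤ dist x y) ∧ μ = (MeasureTheory.Measure.count : MeasureTheory.Measure (EuclideanSpace ℝ (Fin 3))).restrict S)) → (∀ g : MeasureTheory.Measure (EuclideanSpace ℝ (Fin 3)) → EuclideanSpace ℝ (Fin 3) → ENNReal, Measurable (Function.uncurry g) → ∫⁻ μ, ∫⁻ y, g μ y ∂μ ∂P = ∫⁻ μ, ∫⁻ y, g (MeasureTheory.Measure.map (fun z => z - y) μ) (-y) ∂μ ∂P) → (∀ᵐ μ ∂P, ∃ t : ℝ, 0 < t ∧ ∃ A : EuclideanSpace ℝ (Fin 3) ≃ₗᵢ[ℝ] EuclideanSpace ℝ (Fin 3), ∃ h : ℝ, (h = h₀ ∨ h = a₀ * Real.sqrt (2 / 3)) ∧ ∃ s : ℤ → ℤ, Literature.MathematicalPhysics.StatisticalMechanics.IsHaggSeq s ∧ μ = (MeasureTheory.Measure.count : MeasureTheory.Measure (EuclideanSpace ℝ (Fin 3))).restrict ((fun z : EuclideanSpace ℝ (Fin 3) => t • z) '' (A '' Literature.MathematicalPhysics.StatisticalMechanics.barlowStacking a₀ h s))) → (∫ μ, (∫ y, Literature.MathematicalPhysics.StatisticalMechanics.lennardJones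 ‖y‖ ∂μ) / 2 ∂P) ≤ Summit.AtomisticToContinuum.Crystallization.Theorems.PalmUnimodularRigidity.LayeredLawsSelectHcp.hcpE a₀ h₀ → (∀ᵐ μ ∂P, ∃ A : EuclideanSpace ℝ (Fin 3) ≃ₗᵢ[ℝ] EuclideanSpace ℝ (Fin 3), ∃ h : ℝ, (h = h₀ ∨ h = a₀ * Real.sqrt (2 / 3)) ∧ ∃ s : ℤ → ℤ, Literature.MathematicalPhysics.StatisticalMechanics.IsHaggSeq s ∧ μ = (MeasureTheory.Measure.count : MeasureTheory.Measure (EuclideanSpace ℝ (Fin 3))).restrict (A '' Literature.MathematicalPhysics.StatisticalMechanics.barlowStacking a₀ h s)) := by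
  intro a₀ h₀ ha₁ ha₂ hh₁ hh₂ hmin δ _hδ P hP _hHC _hstat hcar hEn
  have ha0 : 0 < a₀ := by linarith
  have hc : hcpE a₀ h₀ < 0 := hcpE_neg_of_isMin hmin
  -- a.s. the root energy is at least the level
  have hge : ∀ᵐ μ ∂P, hcpE a₀ h₀ ≤ (∫ y, lennardJones ‖y‖ ∂μ) / 2 := by
    filter_upwards [hcar] with μ hμ
    obtain ⟨t, ht, A, h, hh, s, hs, rfl⟩ := hμ
    have hpos := (column_box ha₁ ha₂ hh₁ hh₂ hmin hh).1
    rw [smul_image_image_barlowStacking,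
      rootEnergy_eq_barlowSiteEnergy_zero (mul_pos ht ha0) (mul_pos ht hpos) s A]
    exact (siteEnergy_floor_and_pin ha₁ ha₂ hh₁ hh₂ hmin hh hs ht).1
  -- the level is not junk: a.s. equality at the root
  have hae : ∀ᵐ μ ∂P, (∫ y, lennardJones ‖y‖ ∂μ) / 2 = hcpE a₀ h₀ :=
    ae_eq_const_of_integral_le hc hge hEn
  -- equality pins the dilation
  filter_upwards [hcar, hae] with μ hμ hroot
  obtain ⟨t, ht, A, h, hh, s, hs, rfl⟩ := hμ
  have hpos := (column_box ha₁ ha₂ hh₁ hh₂ hmin hh).1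
  rw [smul_image_image_barlowStacking,
    rootEnergy_eq_barlowSiteEnergy_zero (mul_pos ht ha0) (mul_pos ht hpos) s A] at hroot
  have ht1 : t = 1 := (siteEnergy_floor_and_pin ha₁ ha₂ hh₁ hh₂ hmin hh hs ht).2 hroot.le
  subst ht1
  refine ⟨A, h, hh, s, hs, ?_⟩
  rw [smul_image_image_barlowStacking, one_mul, one_mul]

end Summit.AtomisticToContinuum.Crystallization.Theorems.PricedHcpWindowsDilationPinning

end
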